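import Mathlib
import HarnessLib
import HarnessLib.Audit
import Summits.ValiantsHypothesis.ValiantsHypothesis.Theorems.SymmetryDialShiftPerm

/-!
# SymmetryDial — displacement profiles of permutations of `𝔽₂^d` (law (ν) refined)

Route `SymmetryDial` (workshop `decomp-valiant`, lens 1, gen 8), item 23711 (rung-0 instrument
knowledge for the bottom piece P′ = `AffinePebblePairs`).  Gen 7 landed `per M_f ≡ |supp f| (mod 4)`
(`SymmetryDialPerParity.per_grpMat_modEq_four_parity`) for the group matrices `M_f (x, y) = f (x + y)`.
Gen 8 (NODE-g8) refines the permanent `per M_f = #admissible M_f` by the DISPLACEMENT PROFILE of a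
permutation: `σ` lies inside `M_f` iff every displacement `σ x + x` lies in `supp f`
(`mem_admissible_grpMat_iff`), so `per M_f = Σ_n P_d(n)` over the profiles `n : 𝔽₂^d → ℕ` supported
in `supp f`, where `P_d(n) = #profileClass n` counts the permutations with exactly `n c` points of
displacement `c`.

Kernel content of this file (all sorry-free):
* `dispCount σ c`, `profileClass n` and the bookkeeping `sum_dispCount_eq`, `card_admissible_grpMat_eq_sum`
  (`per M_f` is the sum of `#profileClass n` over the profiles of admissible permutations, stated as a
  fiberwise decomposition over `admissible`);
* **Hall's condition (necessity, M. Hall 1952 / Brualdi–Ryser Thm 8.2.2) for `𝔽₂^d`**: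
  `sum_disp_eq_zero : ∑ x, (σ x + x) = 0`, hence `∑ c, dispCount σ c • c = 0`
  (`sum_dispCount_smul_eq_zero`) and `profileClass n = ∅` unless `∑ c, n c • c = 0`
  (`profileClass_eq_empty_of_sum_smul_ne_zero`) — the "odd-sum-zero" constraint visible in every
  census table of NODE-g6..g8.
* The refined laws found numerically in gen 8 are recorded as NAMED CONJECTURES (`@[conjecture]`,
  obligation nodes, not facts): `RefinedProfileLaw d` (ν⁺: `P_d(n) ≡ [2 ∣ n]·multinomial(2^{d-1}; n/2)
  (mod 2^d)`), `RefinedProfileLawSharp d` (ν#: the same mod `2^{d+1}`), and the part of ν# that NODE-g8 §3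
  proves on paper, `OddProfileVanishing d` (a profile with an odd entry has `P_d(n) ≡ 0 (mod 2^{d+1})`).
  ν# ⇒ ν⁺ ⇒ (ν) `per M_f ≡ |supp f| mod 2 (mod 2^d)`; NODE-g8 §3–§4 has the paper proofs
  (odd entries; entries `≡ 2 (mod 4)`; all of ν# for `d ≤ 4`) and the one remaining open class
  (profiles `n ≡ 0 (mod 4)` with affinely spanning support).

LADDER-Valiant rung 0.  References: M. Hall, Proc. AMS 3 (1952) 584–587 (via Brualdi–Ryser,
*Combinatorial Matrix Theory* (1991) Thm 8.2.2, p. 218); NODE-g8 of the workshop lineage.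
-/

namespace Summit.ValiantsHypothesis.ValiantsHypothesis.Theorems.SymmetryDialDisplacementProfile

open Finset Equiv
open SymmetryDialAffinePebble (V)
open SymmetryDialAffinePebbleThree (grpMat)
open SymmetryDialPerCongruence (admissible mem_admissible two_nsmul_eq_zero)
open SymmetryDialShiftPerm (supp)

variable {d : ℕ}

/-! ### 1. Displacements and profiles -/

/-- The displacement of `σ` at `x` (over `𝔽₂^d`, `σ x - x = σ x + x`). -/
def disp (σ : Perm (V d)) (x : V d) : V d := σ x + x

/-- `dispCount σ c` = the number of points `x` with displacement `σ x + x = c`. -/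
def dispCount (σ : Perm (V d)) (c : V d) : ℕ := (univ.filter fun x => disp σ x = c).card

/-- The permutations of `𝔽₂^d` with displacement profile exactly `n`; `P_d(n)` of NODE-g8 is its
cardinality. -/
def profileClass (n : V d → ℕ) : Finset (Perm (V d)) := univ.filter fun σ => ∀ c, dispCount σ c = n c

/-- Membership in `profileClass n`, unfolded. -/
theorem mem_profileClass {n : V d → ℕ} {σ : Perm (V d)} :
    σ ∈ profileClass n ↔ ∀ c, dispCount σ c = n c := by
  simp [profileClass]

/-- The profile of a permutation sums to `2^d` (every point has exactly one displacement). -/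
theorem sum_dispCount_eq (σ : Perm (V d)) : ∑ c, dispCount σ c = 2 ^ d := by
  unfold dispCount
  rw [← card_eq_sum_card_fiberwise (s := univ) (t := univ) (fun x _ => mem_univ (disp σ x))]
  simp

/-- `σ` lies inside the group matrix `M_f` iff all its displacements lie in `supp f`. -/
theorem mem_admissible_grpMat_iff (f : V d → Bool) (σ : Perm (V d)) :
    σ ∈ admissible (grpMat f) ↔ ∀ x, disp σ x ∈ supp f := by
  rw [mem_admissible]
  simp [grpMat, disp, supp]

/-- Equivalently: `σ` is inside `M_f` iff its profile is supported in `supp f`. -/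
theorem mem_admissible_grpMat_iff_dispCount (f : V d → Bool) (σ : Perm (V d)) :
    σ ∈ admissible (grpMat f) ↔ ∀ c, c ∉ supp f → dispCount σ c = 0 := by
  rw [mem_admissible_grpMat_iff]
  constructor
  · intro h c hc
    unfold dispCount
    rw [card_eq_zero, filter_eq_empty_iff]
    intro x _ hx
    exact hc (hx ▸ h x)
  · intro h x
    by_contra hx
    have h0 := h (disp σ x) hx
    unfold dispCount at h0
    rw [card_eq_zero, filter_eq_empty_iff] at h0
    exact h0 (mem_univ x) rfl

/-- `per M_f` decomposes over displacement profiles: `#admissible M_f = Σ_{classes} #(class ∩ admissible)`,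
the classes being the fibres of `σ ↦ (dispCount σ c)_c`; each fibre inside `admissible M_f` is a whole
`profileClass n` with `n` supported in `supp f` (by `mem_admissible_grpMat_iff_dispCount`). -/
theorem card_admissible_grpMat_eq_sum (f : V d → Bool) :
    (admissible (grpMat f)).card =
      ∑ n ∈ (admissible (grpMat f)).image (fun σ c => dispCount σ c),
        ((admissible (grpMat f)).filter fun σ => (fun c => dispCount σ c) = n).card :=
  card_eq_sum_card_image _ _

/-- Inside `M_f`, the fibre over a profile `n` is the full profile class. -/
theorem filter_admissible_eq_profileClass (f : V d → Bool) {n : V d → ℕ}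
    (hn : ∀ c, c ∉ supp f → n c = 0) :
    ((admissible (grpMat f)).filter fun σ => (fun c => dispCount σ c) = n) = profileClass n := by
  ext σ
  simp only [mem_filter, mem_profileClass]
  constructor
  · rintro ⟨-, h⟩ c
    exact congrFun h c
  · intro h
    refine ⟨(mem_admissible_grpMat_iff_dispCount f σ).2 fun c hc => (h c).trans (hn c hc), funext h⟩

/-! ### 2. Hall's condition (necessity) over `𝔽₂^d` -/

/-- The displacements of any permutation of `𝔽₂^d` sum to zero:
`∑ x (σ x + x) = ∑ x σ x + ∑ x x = 2 • ∑ x x = 0`. -/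
theorem sum_disp_eq_zero (σ : Perm (V d)) : ∑ x, disp σ x = 0 := by
  unfold disp
  rw [sum_add_distrib, Equiv.sum_comp σ (fun x => x)]
  exact two_nsmul_eq_zero _

/-- Hall's condition in profile form: `∑_c (dispCount σ c) • c = 0`. -/
theorem sum_dispCount_smul_eq_zero (σ : Perm (V d)) : ∑ c, dispCount σ c • c = 0 := by
  have h := sum_fiberwise' (s := (univ : Finset (V d))) (g := disp σ) (f := fun c : V d => c)
  simp only [sum_const] at h
  unfold dispCount
  rw [h]
  exact sum_disp_eq_zero σ

/-- **Hall 1952, necessity, for `𝔽₂^d`.**  A profile `n` whose weighted sum `∑ c, n c • c` is nonzero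
is realised by no permutation: `P_d(n) = 0`.  (Over `𝔽₂^d` only the parities of the `n c` matter:
the constraint reads `∑_{c : n c odd} c = 0`.) -/
theorem profileClass_eq_empty_of_sum_smul_ne_zero {n : V d → ℕ} (hn : ∑ c, n c • c ≠ 0) :
    profileClass n = ∅ := by
  rw [← not_nonempty_iff_eq_empty]
  rintro ⟨σ, hσ⟩
  rw [mem_profileClass] at hσ
  apply hn
  have h := sum_dispCount_smul_eq_zero σ
  simp_rw [hσ] at h
  exact h

/-- Hall's condition, cardinal form: `P_d(n) = 0` when `∑ c, n c • c ≠ 0`. -/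
theorem card_profileClass_eq_zero_of_sum_smul_ne_zero {n : V d → ℕ} (hn : ∑ c, n c • c ≠ 0) :
    (profileClass n).card = 0 := by
  rw [profileClass_eq_empty_of_sum_smul_ne_zero hn, card_empty]

/-! ### 3. The refined laws of NODE-g8 (named conjectures; obligation nodes, not facts) -/

/-- The predicted residue of `P_d(n)`: `multinomial(2^{d-1}; n/2)` if every entry of `n` is even,
`0` otherwise (NODE-g8 §2: `P_d(n) ≡ [2 ∣ n] · (2^{d-1})! / ∏_c (n c / 2)!`). -/
def profilePrediction (n : V d → ℕ) : ℕ :=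
  if ∀ c, 2 ∣ n c then Nat.multinomial univ (fun c => n c / 2) else 0

/-- **(ν⁺) refined profile law, mod `2^d`** (NODE-g8 §2; verified for `d ≤ 4` exhaustively in the
classes listed there and for `d ≤ 8` through its corollary (ν); proved on paper for every profile with an
entry `≢ 0 (mod 4)`, NODE-g8 §3 T1–T2).  OPEN in general. -/
@[conjecture] def RefinedProfileLaw (d : ℕ) : Prop :=
  ∀ n : V d → ℕ, ∑ c, n c = 2 ^ d → (profileClass n).card ≡ profilePrediction n [MOD 2 ^ d]

/-- **(ν#) refined profile law, mod `2^{d+1}`** (NODE-g8 §2; numerically `d ≤ 4`; proved on paper for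
`d ≤ 4` and, for all `d`, for profiles with an odd entry, NODE-g8 §3).  OPEN in general; implies
`RefinedProfileLaw d` and `per M_f ≡ |supp f| mod 2 (mod 2^{d+1})` for `d ≥ 3`. -/
@[conjecture] def RefinedProfileLawSharp (d : ℕ) : Prop :=
  ∀ n : V d → ℕ, ∑ c, n c = 2 ^ d → (profileClass n).card ≡ profilePrediction n [MOD 2 ^ (d + 1)]

/-- **Odd profiles vanish to order `2^{d+1}`** (NODE-g8 §3 Theorem T1, proved on paper by the
sign-flip expansion of `per (A - 2 a_c P_c)` + Jacobi's complementary-minor identity mod 2; kernel proof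
not yet written — hence recorded as an obligation node). -/
@[conjecture] def OddProfileVanishing (d : ℕ) : Prop :=
  ∀ n : V d → ℕ, (∃ c, ¬ 2 ∣ n c) → (profileClass n).card ≡ 0 [MOD 2 ^ (d + 1)]

/-- ν# is at least as strong as ν⁺ (reduction of the modulus) and contains the odd-profile vanishing
(its `else` branch).  Stated as one conjunction so that neither named conjecture acquires a
(conditional) proof-of-item edge. -/
theorem consequences_of_sharp (h : RefinedProfileLawSharp d) :
    RefinedProfileLaw d ∧ OddProfileVanishing d := by
  refine ⟨fun n hn => Nat.ModEq.of_mul_right 2 (by simpa [pow_succ] using h n hn), ?_⟩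
  intro n hodd
  by_cases hsum : ∑ c, n c = 2 ^ d
  · have h1 := h n hsum
    have hp : profilePrediction n = 0 := by
      unfold profilePrediction
      rw [if_neg (not_forall.2 (by obtain ⟨c, hc⟩ := hodd; exact ⟨c, hc⟩))]
    rwa [hp] at h1
  · -- a profile not summing to `2^d` is realised by no permutation
    have : profileClass n = ∅ := by
      rw [← not_nonempty_iff_eq_empty]
      rintro ⟨σ, hσ⟩
      apply hsum
      rw [mem_profileClass] at hσ
      simpa [hσ] using sum_dispCount_eq σ
    rw [this, card_empty]

end Summit.ValiantsHypothesis.ValiantsHypothesis.Theorems.SymmetryDialDisplacementProfile
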